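import Literature.AlgebraicGeometry.Resolution.CompletionFiniteAlgebra
import Literature.AlgebraicGeometry.Resolution.FormalFibresRegular
import Literature.AlgebraicGeometry.Resolution.RegularCentreLocal
import Mathlib.RingTheory.TensorProduct.Pi
import Mathlib.RingTheory.Localization.BaseChange
import Mathlib.RingTheory.Localization.LocalizationLocalization
import HarnessLib

/-!
# Formal fibres along finite maps: discharge of `Stacks07PP_finite_generic` (Stacks 07PP (1))

Topic: `Literature/AlgebraicGeometry/Resolution`. Proof of the second leaf of the decomposition
of Matsumura's Thm. 32.3 (`FormalFibres.lean`): geometric regularity of the generic formal fibre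
goes up along a finite injective extension `R ⊆ R'` of Noetherian domains, from `R_{𝔭' ∩ R}`
to `R'_{𝔭'}` (Stacks, Tag 07PP (1) in the finite generic case; Matsumura p. 258: `B^* ⊗_B L`
"is hence a direct factor of `B'^* ⊗_{B'} L = S^* ⊗_S L = (S^* ⊗_S K) ⊗_K L`"). Everything is
PROVED:

* `IsRegularRing.of_pi` — a factor of a finite product of rings is regular when the product is
  (it is the localisation at the corresponding idempotent).
* `isRegularRing_tensor_completion_localization` — the key computation (Matsumura p. 258 /
  Stacks 07PP, proof: "Hence `R'_{𝔭'} → (R'_{𝔭'})^∧` is a factor of a base change of the map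
  `R_𝔭 → R_𝔭^∧`"): for a finite algebra `C` over a Noetherian local ring `S`, a maximal ideal
  `𝔫` of `C` and any `C_𝔫`-algebra `L`: `L ⊗_{C_𝔫} (C_𝔫)^` is a factor of
  `L ⊗_C (C ⊗_S Ŝ) = L ⊗_S Ŝ` (by `Stacks07N9_local`, `CompletionFiniteAlgebra.lean`), hence regular
  when `L ⊗_S Ŝ` is.
* `isGeometricallyRegular_fibre_localization_of_finite` — **Stacks 07PP (1) for a finite
  algebra over a local ring**: if the formal fibre of `S` over `Q ∩ S` is geometrically regular
  then so is the formal fibre of `C_𝔫` over `Q` (the residue field extension `κ(Q)/κ(Q ∩ S)` is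
  finite, Mathlib's quasi-finiteness of finite algebras).
* `Stacks07PP_finite_generic_holds : Stacks07PP_finite_generic` — the DISCHARGE: for
  `R ⊆ R'` finite, `𝔭 = 𝔭' ∩ R`, `S = R_𝔭`, `C = S ⊗_R R'` is finite over `S`, `𝔫 = 𝔭'C` is
  maximal and `C_𝔫 ≅ R'_{𝔭'}`; primes of `R'_{𝔭'}` over `(0) ⊆ R'` go to primes of `S` over
  `(0) ⊆ R`.
* `Matsumura1987_32_3_of_cohen` — consequently Thm. 32.3 follows from the three remaining named
  facts `Matsumura1987_29_4_iii`, `Matsumura1987_29_7_equichar` (Cohen structure theorems) and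
  `Stacks07PR_powerSeries` (`FormalFibresRegular.lean`).

## Sources

* The Stacks Project, Tag 07PP: "(1) If the formal fibre `R_𝔭^∧ ⊗_R κ(𝔮)` is geometrically
  regular over `κ(𝔮)`, then the formal fibre `(R'_{𝔭'})^∧ ⊗_{R'} κ(𝔮')` is geometrically
  regular over `κ(𝔮')`" (for `R → R'` of finite type, quasi-finite at `𝔭'`; vendored for finite
  injective maps of domains and `𝔮 = 𝔮' = (0)` as `Stacks07PP_finite_generic`), and its proof:
  "Hence `R'_{𝔭'} → (R'_{𝔭'})^∧` is a factor of a base change of the map `R_𝔭 → R_𝔭^∧`. It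
  follows that `(R'_{𝔭'})^∧ ⊗_{R'} κ(𝔮')` is a factor of
  `R_𝔭^∧ ⊗_R R' ⊗_{R'} κ(𝔮') = R_𝔭^∧ ⊗_R κ(𝔮) ⊗_{κ(𝔮)} κ(𝔮')`. Thus the result follows as
  extension of base field preserves geometric regularity"; Tag 07N9. [StacksProject]
* H. Matsumura, *Commutative Ring Theory*, CUP 1986, proof of Thm. 32.3, p. 258 [PDF 276].
  [Matsumura1987]
-/

noncomputable section

namespace Literature.AlgebraicGeometry.Resolution

universe u

open IsLocalRing TensorProduct

/-! ## A factor of a regular product ring is regular -/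

/-- The projection `Π Xᵢ → X_{i₀}` is the localisation at the idempotent `e_{i₀}`. [folklore] -/
theorem isLocalization_away_pi_single {ι : Type u} [DecidableEq ι] (X : ι → Type u)
    [∀ i, CommRing (X i)] (i₀ : ι) :
    letI := (Pi.evalRingHom X i₀).toAlgebra
    IsLocalization.Away (Pi.single i₀ 1 : ∀ i, X i) (X i₀) := by
  letI := (Pi.evalRingHom X i₀).toAlgebra
  refine IsLocalization.away_of_isIdempotentElem_of_mul ?_ (fun x y => ?_) fun x => ⟨Pi.single i₀ x, ?_⟩
  · rw [IsIdempotentElem, ← Pi.single_mul, mul_one]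
  · change x i₀ = y i₀ ↔ _
    constructor
    · intro h
      funext j
      by_cases hj : j = i₀
      · subst hj; simpa using h
      · simp [hj]
    · intro h
      have := congrFun h i₀
      simpa using this
  · change (Pi.single i₀ x : ∀ i, X i) i₀ = x
    simp

/-- **A factor of a regular finite product of rings is regular** (the factor is a localisation
of the product). [folklore] -/
theorem IsRegularRing.of_pi {ι : Type u} (X : ι → Type u) [∀ i, CommRing (X i)]
    [IsRegularRing (∀ i, X i)] (i₀ : ι) : IsRegularRing (X i₀) := by
  classical
  letI := (Pi.evalRingHom X i₀).toAlgebra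
  haveI := isLocalization_away_pi_single X i₀
  exact isRegularRing_of_isLocalization (Submonoid.powers (Pi.single i₀ 1 : ∀ i, X i)) (X i₀)

/-! ## The completion of `C_𝔫` is a factor of `C ⊗_S Ŝ`, after any base change -/

section Factor

variable (S C L : Type u) [CommRing S] [CommRing C] [CommRing L] [Algebra S C] [IsLocalRing S]
  [IsNoetherianRing S] [Module.Finite S C] (n : Ideal C) [hn : n.IsMaximal]
  [Algebra C L] [Algebra S L] [IsScalarTower S C L]
  [Algebra (Localization.AtPrime n) L] [IsScalarTower C (Localization.AtPrime n) L]

/-- `IsScalarTower C C_𝔫 (C_𝔫)^`. [folklore] -/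
theorem isScalarTower_adicCompletion_localization :
    IsScalarTower C (Localization.AtPrime n)
      (AdicCompletion (maximalIdeal (Localization.AtPrime n)) (Localization.AtPrime n)) :=
  IsScalarTower.of_algebraMap_eq fun c => by
    rw [AdicCompletion.algebraMap_apply, AdicCompletion.algebraMap_apply, Algebra.algebraMap_self,
      RingHom.id_apply]

/-- **`L ⊗_{C_𝔫} (C_𝔫)^` is regular as soon as `L ⊗_S Ŝ` is**, for `C` finite over the
Noetherian local ring `S`, `𝔫` a maximal ideal of `C` and `L` any `C_𝔫`-algebra: indeed
`L ⊗_{C_𝔫} (C_𝔫)^ = L ⊗_C (C_𝔫)^` (`C → C_𝔫` is an epimorphism) is the `𝔫`-th factor of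
`L ⊗_C Π_{𝔫'} (C_{𝔫'})^ ≅ L ⊗_C (C ⊗_S Ŝ) ≅ L ⊗_S Ŝ` (Stacks 07N9). This is the computation
"Hence `R'_{𝔭'} → (R'_{𝔭'})^∧` is a factor of a base change of the map `R_𝔭 → R_𝔭^∧`" of the
proof of Stacks 07PP, resp. Matsumura's: `B^* ⊗_B L` "is hence a direct factor of
`B'^* ⊗_{B'} L = S^* ⊗_S L = (S^* ⊗_S K) ⊗_K L`" (p. 258). [cite: StacksProject, Tag 07PP (proof)] -/
theorem isRegularRing_tensor_completion_localization
    (hreg : IsRegularRing (L ⊗[S] AdicCompletion (maximalIdeal S) S)) :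
    IsRegularRing (L ⊗[Localization.AtPrime n]
      AdicCompletion (maximalIdeal (Localization.AtPrime n)) (Localization.AtPrime n)) := by
  classical
  haveI : Fintype (MaximalSpectrum C) :=
    @Fintype.ofFinite _ (finite_maximalSpectrum_of_finite S C)
  -- the product of all the `L ⊗_C (C_𝔫')^` is `L ⊗_S Ŝ`, hence regular
  let P : MaximalSpectrum C → Type u := fun n' =>
    L ⊗[C] AdicCompletion (maximalIdeal (Localization.AtPrime n'.asIdeal))
      (Localization.AtPrime n'.asIdeal)
  let e₂ := Algebra.TensorProduct.piRight C L L fun n' : MaximalSpectrum C =>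
    AdicCompletion (maximalIdeal (Localization.AtPrime n'.asIdeal)) (Localization.AtPrime n'.asIdeal)
  let e₃ := Algebra.TensorProduct.congr (AlgEquiv.refl (R := L) (A₁ := L)) (Stacks07N9_local S C).symm
  let e₄ := Algebra.TensorProduct.cancelBaseChange S C L L (AdicCompletion (maximalIdeal S) S)
  haveI hprod : IsRegularRing (∀ n' : MaximalSpectrum C, P n') :=
    IsRegularRing.of_ringEquiv (R := L ⊗[S] AdicCompletion (maximalIdeal S) S)
      ((e₃.trans e₄).symm.trans e₂).toRingEquiv
  -- its `𝔫`-th factor is `L ⊗_C (C_𝔫)^ = L ⊗_{C_𝔫} (C_𝔫)^`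
  have hfac : IsRegularRing (P ⟨n, hn⟩) := IsRegularRing.of_pi P ⟨n, hn⟩
  haveI := isScalarTower_adicCompletion_localization C n
  let e₁ := Algebra.TensorProduct.equivOfCompatibleSMul C (Localization.AtPrime n) L L
    (AdicCompletion (maximalIdeal (Localization.AtPrime n)) (Localization.AtPrime n))
  exact IsRegularRing.of_ringEquiv (R := P ⟨n, hn⟩) e₁.symm.toRingEquiv

end Factor


/-! ## Stacks 07PP (1) for a finite algebra over a local ring -/

section GoesUp

variable (S C : Type u) [CommRing S] [CommRing C] [Algebra S C] [IsLocalRing S]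
  [IsNoetherianRing S] [Module.Finite S C] (n : Ideal C) [hn : n.IsMaximal]

/-- **Stacks 07PP (1), for a finite algebra `C` over a Noetherian local ring `S` and a maximal
ideal `𝔫` of `C`** (so `𝔫` lies over `𝔪_S`): for a prime `Q` of `C_𝔫` over `P₀ = Q ∩ S`, if the
formal fibre `κ(P₀) ⊗_S Ŝ` of `S` over `P₀` is geometrically regular over `κ(P₀)`, then the
formal fibre `κ(Q) ⊗_{C_𝔫} (C_𝔫)^` of `C_𝔫` over `Q` is geometrically regular over `κ(Q)`.
Proof as in Stacks: `κ(Q)` is finite over `κ(P₀)` (finite algebras are quasi-finite), so a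
finite extension `L` of `κ(Q)` is finite over `κ(P₀)`, `L ⊗_S Ŝ = L ⊗_{κ(P₀)} (κ(P₀) ⊗_S Ŝ)` is
regular, and `L ⊗_{κ(Q)} (κ(Q) ⊗_{C_𝔫} (C_𝔫)^) = L ⊗_{C_𝔫} (C_𝔫)^` is a factor of it
(`isRegularRing_tensor_completion_localization`). [cite: StacksProject, Tag 07PP (1)] -/
theorem isGeometricallyRegular_fibre_localization_of_finite
    (Q : Ideal (Localization.AtPrime n)) [Q.IsPrime]
    (H : IsGeometricallyRegular (Q.comap (algebraMap S (Localization.AtPrime n))).ResidueField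
      ((Q.comap (algebraMap S (Localization.AtPrime n))).ResidueField ⊗[S]
        AdicCompletion (maximalIdeal S) S)) :
    IsGeometricallyRegular Q.ResidueField
      (Q.ResidueField ⊗[Localization.AtPrime n]
        AdicCompletion (maximalIdeal (Localization.AtPrime n)) (Localization.AtPrime n)) := by
  intro L _ _ hL
  haveI := hL
  haveI : Q.LiesOver (Q.comap (algebraMap S (Localization.AtPrime n))) := ⟨rfl⟩
  -- `L` as an algebra over `C_𝔫`, `C`, `S`
  letI : Algebra (Localization.AtPrime n) L :=
    ((algebraMap Q.ResidueField L).comp (algebraMap _ Q.ResidueField)).toAlgebra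
  haveI : IsScalarTower (Localization.AtPrime n) Q.ResidueField L :=
    IsScalarTower.of_algebraMap_eq fun _ => rfl
  letI : Algebra C L := ((algebraMap (Localization.AtPrime n) L).comp (algebraMap C _)).toAlgebra
  haveI : IsScalarTower C (Localization.AtPrime n) L := IsScalarTower.of_algebraMap_eq fun _ => rfl
  letI : Algebra S L := ((algebraMap C L).comp (algebraMap S C)).toAlgebra
  haveI : IsScalarTower S C L := IsScalarTower.of_algebraMap_eq fun _ => rfl
  -- the residue field extension `κ(P₀) → κ(Q)` is finite
  letI := Localization.AtPrime.algebraOfLiesOver (Q.comap (algebraMap S (Localization.AtPrime n))) Q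
  haveI : Module.Finite (Q.comap (algebraMap S (Localization.AtPrime n))).ResidueField
      Q.ResidueField := inferInstance
  letI : Algebra (Q.comap (algebraMap S (Localization.AtPrime n))).ResidueField L :=
    ((algebraMap Q.ResidueField L).comp (algebraMap _ Q.ResidueField)).toAlgebra
  haveI : IsScalarTower (Q.comap (algebraMap S (Localization.AtPrime n))).ResidueField
      Q.ResidueField L := IsScalarTower.of_algebraMap_eq fun _ => rfl
  haveI : Module.Finite (Q.comap (algebraMap S (Localization.AtPrime n))).ResidueField L :=
    Module.Finite.trans Q.ResidueField L
  haveI : IsScalarTower S (Q.comap (algebraMap S (Localization.AtPrime n))).ResidueField L := by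
    refine IsScalarTower.of_algebraMap_eq fun s => ?_
    change algebraMap Q.ResidueField L (algebraMap (Localization.AtPrime n) Q.ResidueField
        (algebraMap C (Localization.AtPrime n) (algebraMap S C s))) =
      algebraMap Q.ResidueField L (algebraMap _ Q.ResidueField (algebraMap S _ s))
    congr 1
    rw [← IsScalarTower.algebraMap_apply S _ Q.ResidueField,
      ← IsScalarTower.algebraMap_apply S C (Localization.AtPrime n),
      ← IsScalarTower.algebraMap_apply S (Localization.AtPrime n) Q.ResidueField]
  -- the formal fibre of `S`, base-changed to `L`, is regular
  haveI := H L inferInstance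
  have hreg : IsRegularRing (L ⊗[S] AdicCompletion (maximalIdeal S) S) :=
    IsRegularRing.of_ringEquiv
      (Algebra.TensorProduct.cancelBaseChange S
        (Q.comap (algebraMap S (Localization.AtPrime n))).ResidueField L L
        (AdicCompletion (maximalIdeal S) S)).toRingEquiv
  -- hence so is its factor `L ⊗_{C_𝔫} (C_𝔫)^`
  haveI := isRegularRing_tensor_completion_localization S C L n hreg
  exact IsRegularRing.of_ringEquiv
    (Algebra.TensorProduct.cancelBaseChange (Localization.AtPrime n) Q.ResidueField L L
      (AdicCompletion (maximalIdeal (Localization.AtPrime n)) (Localization.AtPrime n))).symm.toRingEquiv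

end GoesUp


/-! ## Discharge of the leaf `Stacks07PP_finite_generic` -/

/-- DISCHARGE of the named fact `Stacks07PP_finite_generic` (`FormalFibres.lean`): **Stacks 07PP
(1) in the finite generic case** — for a finite injective extension `R ⊆ R'` of Noetherian
domains and a prime `𝔭'` of `R'` over `𝔭`, geometric regularity of the generic formal fibre
passes from `R_𝔭` to `R'_{𝔭'}`. With `S = R_𝔭`, `C = S ⊗_R R'` (finite over `S`, a localisation
of `R'`) and the maximal ideal `𝔫 = 𝔭'C`: `R'_{𝔭'} ≅ C_𝔫`, primes of `R'_{𝔭'}` over `(0) ⊆ R'`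
contract to primes of `S` over `(0) ⊆ R`, and `isGeometricallyRegular_fibre_localization_of_finite`
applies. [cite: StacksProject, Tag 07PP (1)] -/
theorem Stacks07PP_finite_generic_holds : Stacks07PP_finite_generic.{u} := by
  intro R R' _ _ _ _ _ _ hinj hfin p' _ H Q _ hQ
  haveI := hfin
  set p : Ideal R := p'.comap (algebraMap R R') with hp
  -- `C = R_𝔭 ⊗_R R'`, an `R_𝔭`-algebra on the left and an `R'`-algebra on the right
  letI : Algebra R' (Localization.AtPrime p ⊗[R] R') := Algebra.TensorProduct.rightAlgebra
  haveI : IsNoetherianRing (Localization.AtPrime p ⊗[R] R') :=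
    isNoetherian_of_tower (Localization.AtPrime p) inferInstance
  -- `C` is the localisation of `R'` at the image `M` of `R ∖ 𝔭`
  have hdisj : Disjoint ((Algebra.algebraMapSubmonoid R' p.primeCompl : Submonoid R') : Set R')
      (p' : Set R') := by
    rw [Set.disjoint_left]
    rintro _ ⟨r, hr, rfl⟩ hr'
    exact hr hr'
  haveI hnP : (p'.map (algebraMap R' (Localization.AtPrime p ⊗[R] R'))).IsPrime :=
    IsLocalization.isPrime_of_isPrime_disjoint (Algebra.algebraMapSubmonoid R' p.primeCompl) _ p'
      ‹_› hdisj
  have hunder : (p'.map (algebraMap R' (Localization.AtPrime p ⊗[R] R'))).comap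
      (algebraMap R' (Localization.AtPrime p ⊗[R] R')) = p' :=
    IsLocalization.under_map_of_isPrime_disjoint (Algebra.algebraMapSubmonoid R' p.primeCompl) _
      ‹_› hdisj
  -- `𝔫 = 𝔭'C` is maximal: it contains `𝔪_{R_𝔭} C = 𝔭C`
  haveI hn : (p'.map (algebraMap R' (Localization.AtPrime p ⊗[R] R'))).IsMaximal := by
    refine isMaximal_of_isPrime_of_map_maximalIdeal_le (Localization.AtPrime p) _ _ ?_
    rw [← Localization.AtPrime.map_eq_maximalIdeal, Ideal.map_map,
      ← IsScalarTower.algebraMap_eq R (Localization.AtPrime p),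
      IsScalarTower.algebraMap_eq R R' (Localization.AtPrime p ⊗[R] R'), ← Ideal.map_map]
    exact Ideal.map_mono Ideal.map_comap_le
  -- `C_𝔫 ≅ R'_{𝔭'}` over `R'`
  have hX := IsLocalization.isLocalization_isLocalization_atPrime_isLocalization
    (Algebra.algebraMapSubmonoid R' p.primeCompl)
    (Localization.AtPrime (p'.map (algebraMap R' (Localization.AtPrime p ⊗[R] R'))))
    (p'.map (algebraMap R' (Localization.AtPrime p ⊗[R] R')))
  have hM : ((p'.map (algebraMap R' (Localization.AtPrime p ⊗[R] R'))).comap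
      (algebraMap R' (Localization.AtPrime p ⊗[R] R'))).primeCompl = p'.primeCompl :=
    Submonoid.ext fun x => by rw [Ideal.mem_primeCompl_iff, Ideal.mem_primeCompl_iff, hunder]
  change IsLocalization ((p'.map (algebraMap R' (Localization.AtPrime p ⊗[R] R'))).comap
      (algebraMap R' (Localization.AtPrime p ⊗[R] R'))).primeCompl _ at hX
  rw [hM] at hX
  let e : Localization.AtPrime (p'.map (algebraMap R' (Localization.AtPrime p ⊗[R] R'))) ≃ₐ[R']
      Localization.AtPrime p' :=
    @IsLocalization.algEquiv R' _ p'.primeCompl _ _ _ hX (Localization.AtPrime p') _ _ _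
  letI : Algebra (Localization.AtPrime (p'.map (algebraMap R' (Localization.AtPrime p ⊗[R] R'))))
      (Localization.AtPrime p') := (e : _ →+* Localization.AtPrime p').toAlgebra
  have hφ : Function.Surjective (algebraMap
      (Localization.AtPrime (p'.map (algebraMap R' (Localization.AtPrime p ⊗[R] R'))))
      (Localization.AtPrime p')) := e.surjective
  -- transport the fibre over `Q` to the fibre of `C_𝔫` over `Q₁ = Q ∩ C_𝔫`, and go up from `R_𝔭`
  refine isGeometricallyRegular_fibre_completion_of_surjective hφ Q
    (isGeometricallyRegular_fibre_localization_of_finite (Localization.AtPrime p)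
      (Localization.AtPrime p ⊗[R] R') _ _ (H _ ?_))
  -- the prime of `R_𝔭` below `Q` lies over `(0) ⊆ R`, because `Q` lies over `(0) ⊆ R'`
  have hcomp : ((algebraMap _ (Localization.AtPrime p')).comp
      (algebraMap (Localization.AtPrime p)
        (Localization.AtPrime (p'.map (algebraMap R' (Localization.AtPrime p ⊗[R] R')))))).comp
      (algebraMap R (Localization.AtPrime p)) =
      (algebraMap R' (Localization.AtPrime p')).comp (algebraMap R R') :=
    RingHom.ext fun r => by
      change e (algebraMap (Localization.AtPrime p) _ (algebraMap R (Localization.AtPrime p) r)) =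
        algebraMap R' (Localization.AtPrime p') (algebraMap R R' r)
      rw [← IsScalarTower.algebraMap_apply R (Localization.AtPrime p),
        IsScalarTower.algebraMap_apply R R'
          (Localization.AtPrime (p'.map (algebraMap R' (Localization.AtPrime p ⊗[R] R')))),
        AlgEquiv.commutes]
  change ((Q.comap (algebraMap _ (Localization.AtPrime p'))).comap
      (algebraMap (Localization.AtPrime p) _)).comap (algebraMap R (Localization.AtPrime p)) = ⊥
  rw [Ideal.comap_comap, Ideal.comap_comap, ← RingHom.comp_assoc, hcomp, ← Ideal.comap_comap, hQ,
    Ideal.comap_bot_of_injective _ hinj]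


/-! ## Matsumura's Thm. 32.3 from the three remaining (deep) leaves -/

/-- **Matsumura, Thm. 32.3, reduced to Cohen's structure theorems and Stacks 07PR**: with
`Stacks07PP_finite_generic` now proved, "a complete Noetherian local ring is a G-ring" follows
from the named facts `Matsumura1987_29_4_iii` (Cohen, Thm. 29.4 (iii)),
`Matsumura1987_29_7_equichar` (Cohen, Thm. 29.7, equal characteristic) and
`Stacks07PR_powerSeries` (the characteristic-`p` computation for `k⟦X_1, …, X_n⟧`).
[cite: Matsumura1987, Thm. 32.3 and its proof, pp. 257–259] -/
theorem Matsumura1987_32_3_of_cohen (hC : Matsumura1987_29_4_iii.{u})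
    (hS : Matsumura1987_29_7_equichar.{u}) (hP : Stacks07PR_powerSeries.{u}) :
    Matsumura1987_32_3.{u} :=
  Matsumura1987_32_3_of_leaves' hC Stacks07PP_finite_generic_holds hS hP

end Literature.AlgebraicGeometry.Resolution

end
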